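import Summits.ResolutionOfSingularities.ResolutionOfSingularities.Theorems.FrobeniusClosingPatchingRelPerfectDepthLegalPieces
import Summits.ResolutionOfSingularities.ResolutionOfSingularities.Theorems.EquisingularLiftEquisingularLiftNatStrictTransformSupport
import Literature.AlgebraicGeometry.Resolution.BlowupSNC
import HarnessLib

/-!
# Crux `PatchingRelPerfect` (stmt-ResolutionOfSingularities-16161), chain W5.2 — T6-E1b residual
# `LegalScopedDivisorReduction₃` / `LegalDivisorReduction₃`: the pure weight-two pieces loop, `𝔟`-KEYED legality and
# MEMBER-WISE boundary transport (for the PHASE-2 hand)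

[OURS · L1 W5.2 · `LegalScopedDivisorReduction₃` (res-L1-w52-idea-1 OWNER RULING O1), hand #2 (res-type-049) for hand #1
(res-D-pv-016 AS res-L1-w52-stub-5, ask 2026-08-27T12:01:40Z), brick 1b] Fact-free; NOT statements of the manuscript under review.

Sibling of `…DepthLegalPieces` (`WeightTwoB.pure_pieces_loop`: legality keyed on the HOST order, boundary tracked by a bound
`B₀`). PHASE 2 of the intended proof runs with a REGULAR host (order one everywhere), its centres being legal because they lie
on the host AND on a positive-exponent boundary member: so the loop is re-issued here with

* the legality hypothesis keyed on `𝔟` itself — «`2 ≤ ord_z 𝔟` at every point of every piece» (weaker than host order `≥ 2`;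
  transported to the remaining, disjoint, pieces by the same (L-D) lemma `IsBlowup.idealOrder_controlledTransform_eq_of_not_mem`);
* the MEMBER-WISE transport of the boundary list made explicit: every OLD member `p ∈ ℬ` has a transform `p' ∈ ℬ'` with the
  SAME exponent whose support contains `τ⁻¹(Supp p ∖ V(C))` and lies over `Supp p` (iterated `strictTransformIdeal`;
  res-L1-w45b-stub-1's `preimage_diff_subset_support_strictTransformIdeal`, `mem_support_of_mem_support_strictTransformIdeal`), and
  every member of `ℬ'` is such a transform OR is exceptional (support over `V(C)`).

* `pure_piece_single_keyed` — one legal piece; * `pure_pieces_loop_keyed` — all pieces of a regular centre.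

AI-written; AI review is weaker than expert review.

## References
* E. Bierstone, D. Grigoriev, P. Milman, J. Włodarczyk, arXiv:1206.3090, Def. 3.1.3, Lemma 3.2.1 (1), §4 Step 2b.
  [BierstoneGrigorievMilmanWlodarczyk2011]
* J. Kollár, *Lectures on Resolution of Singularities* (2007), 3.30.2. [Kollar2007]
* U. Görtz, T. Wedhorn, *Algebraic Geometry I* (2nd ed. 2020), (13.19). [GortzWedhorn2020]
* The Stacks Project, Tag 080A. [StacksProject]
-/

-- `Summit.<Summit>.<Sub>.Theorems` with `Sub = Summit` (single-conjunct summit, D-0017)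
set_option linter.dupNamespace false

noncomputable section

open CategoryTheory CategoryTheory.Limits AlgebraicGeometry TopologicalSpace IsLocalRing
open Literature.AlgebraicGeometry.Resolution Scheme.IdealSheafData

namespace Summit.ResolutionOfSingularities.ResolutionOfSingularities.Theorems

universe u

namespace WeightTwoB

open DepthTargets
open Summit.ResolutionOfSingularities.ResolutionOfSingularities.Cruxes.EquisingularLiftNat.Sections
  (preimage_diff_subset_support_strictTransformIdeal)

/-! ## §1 Legality of a piece along which `𝔟` has order at least two -/

section Legal

variable {W : Scheme.{u}} [IsLocallyNoetherian W] {𝔟 D : W.IdealSheafData} {ℬ 𝒟 : List (W.IdealSheafData × ℕ)}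

/-- **A piece along which `𝔟` has order `≥ 2` is LEGAL: `𝔟 ≤ 𝓘(Z)²`** (order `≥ 2` at every point of the regular centre
`V(𝓘(Z)) = Z` of the regular scheme `W`). [cite: BierstoneGrigorievMilmanWlodarczyk2011, Lemma 3.2.1 (1)] -/
theorem StateIn.le_vanishingIdeal_sq_of_forall_two_le' (S : StateIn 𝔟 D ℬ 𝒟) {Z : Closeds W} (Γ : CentreIn D ℬ Z)
    (h2 : ∀ z ∈ (Z : Set W), (2 : ℕ∞) ≤ idealOrder 𝔟 z) : 𝔟 ≤ vanishingIdeal Z ^ 2 := by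
  refine le_pow_of_isRegular_subscheme_of_forall_le_idealOrder_of_isRegular S.regW Γ.regZ fun y hy => ?_
  have hy' : y ∈ (Z : Set W) := by rw [← Scheme.IdealSheafData.coe_support_vanishingIdeal Z]; exact hy
  exact h2 y hy'

end Legal

/-! ## §2 One legal piece, member-wise -/

/-- **The single LEGAL piece, `𝔟`-keyed, with member-wise boundary transport**: as `pure_piece_single`, the legality
hypothesis being «`2 ≤ ord_z 𝔟` on `Z`», and with the two member clauses — every old member `p ∈ ℬ` is carried to
`(strictTransformIdeal τ 𝓘(Z) p.1, p.2) ∈ ℬ'` (same exponent, support `⊇ τ⁻¹(Supp p.1 ∖ Z)` and `⊆ τ⁻¹ Supp p.1`), and every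
member of `ℬ'` is such a transform or the exceptional `(𝓘(Z)𝒪, e)` (support `⊆ τ⁻¹ Z`).
[cite: BierstoneGrigorievMilmanWlodarczyk2011, §4 Step 2b, Lemma 3.2.1 (1)] [cite: GortzWedhorn2020, (13.19)] -/
theorem pure_piece_single_keyed
    {E W : Scheme.{u}} [IsIntegral W] [IsNoetherian W] {ρ : W ⟶ E} {𝔟₀ : E.IdealSheafData}
    {𝔟 D : W.IdealSheafData} {ℬ 𝒟 : List (W.IdealSheafData × ℕ)} (S : StateIn 𝔟 D ℬ 𝒟)
    (hseq : IsPureWeightedSeq 2 ρ 𝔟₀ 𝔟)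
    {Z : Closeds W} (Γ : CentreIn D ℬ Z) (h2 : ∀ z ∈ (Z : Set W), (2 : ℕ∞) ≤ idealOrder 𝔟 z)
    {W' : Scheme.{u}} {τ : W' ⟶ W} (hτ : IsBlowup τ (vanishingIdeal Z)) :
    ∃ (_ : IsIntegral W') (_ : IsNoetherian W') (m e e' : ℕ),
      IsPureWeightedSeq 2 (τ ≫ ρ) 𝔟₀ (controlledTransform τ (vanishingIdeal Z) 𝔟 2) ∧
        StateIn (controlledTransform τ (vanishingIdeal Z) 𝔟 2) (controlledTransform τ (vanishingIdeal Z) D m)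
          (stepExp ℬ τ (vanishingIdeal Z) e) (stepExp 𝒟 τ (vanishingIdeal Z) e') ∧
        controlledTransform τ (vanishingIdeal Z) D m =
          vanishingIdeal (controlledTransform τ (vanishingIdeal Z) D m).support ∧
        (((controlledTransform τ (vanishingIdeal Z) D m).support : Set W') =
          closure (τ ⁻¹' ((D.support : Set W) \ (Z : Set W)))) ∧
        (∀ p ∈ ℬ, ∃ p' ∈ stepExp ℬ τ (vanishingIdeal Z) e, p'.2 = p.2 ∧
          τ ⁻¹' ((p.1.support : Set W) \ (Z : Set W)) ⊆ (p'.1.support : Set W') ∧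
          (p'.1.support : Set W') ⊆ τ ⁻¹' (p.1.support : Set W)) ∧
        (∀ p' ∈ stepExp ℬ τ (vanishingIdeal Z) e,
          (∃ p ∈ ℬ, p'.2 = p.2 ∧ τ ⁻¹' ((p.1.support : Set W) \ (Z : Set W)) ⊆ (p'.1.support : Set W') ∧
            (p'.1.support : Set W') ⊆ τ ⁻¹' (p.1.support : Set W)) ∨
          (p'.1.support : Set W') ⊆ τ ⁻¹' (Z : Set W)) := by
  obtain ⟨η, hη⟩ := Γ.exists_isGenericPoint
  have P : PieceIn 𝔟 D ℬ 𝒟 Z η := S.pieceIn Γ hη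
  obtain ⟨m, hm, hm1⟩ := P.exists_idealOrder_host_eq
  -- the centre is not the zero ideal: `Z ⊆ Supp D`, a proper closed subset
  have hCne : vanishingIdeal Z ≠ ⊥ := by
    intro h0
    have hZ : (Z : Set W) = Set.univ := by
      rw [← Scheme.IdealSheafData.coe_support_vanishingIdeal Z, h0, Scheme.IdealSheafData.support_bot]; rfl
    have hdense := S.hostCartier.dense_compl_support
    have hempty : ((D.support : Set W)ᶜ) = ∅ := by
      rw [Set.compl_empty_iff, Set.eq_univ_iff_forall]
      intro x
      exact Γ.subZ (by rw [hZ]; trivial)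
    have := hdense.nonempty
    rw [hempty] at this
    exact Set.not_nonempty_empty this
  haveI hint' : IsIntegral W' := hτ.isIntegral hCne
  haveI hnoeth' : IsNoetherian W' := isNoetherian_of_isBlowup hτ
  -- reducedness of the carried host ((L-D))
  have hDrad : D.radical = D := by
    conv_rhs => rw [S.hostRad]
    rw [Scheme.IdealSheafData.vanishingIdeal_support]
  have hrad' : (controlledTransform τ (vanishingIdeal Z) D m).radical = controlledTransform τ (vanishingIdeal Z) D m :=
    hτ.radical_controlledTransform_eq S.regW Γ.regZ P.gen' (P.subZ P.η_mem) hm S.hostCartier hDrad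
  have hrad : controlledTransform τ (vanishingIdeal Z) D m =
      vanishingIdeal (controlledTransform τ (vanishingIdeal Z) D m).support := by
    rw [Scheme.IdealSheafData.vanishingIdeal_support, hrad']
  -- the piece is legal: weight two
  have hw : pieceWeight 𝔟 (Z : Set W) = 2 := (pieceWeight_eq_two_iff 𝔟 _).mpr h2
  have hle2 : 𝔟 ≤ vanishingIdeal Z ^ 2 := S.le_vanishingIdeal_sq_of_forall_two_le' Γ h2
  set w := weightOf ℬ (divisorsOver ℬ (vanishingIdeal Z) (vanishingIdeal Z).support) with hwdef
  set w𝒟 := weightOf 𝒟 (divisorsOver 𝒟 (vanishingIdeal Z) (vanishingIdeal Z).support) with hw𝒟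
  -- the new state (res-D-pv-054), read with weight two
  have S' := stateIn' S Γ hη hτ hm hrad
  rw [hw] at S'
  have hZsupp : ((vanishingIdeal Z).support : Set W) = Z := Scheme.IdealSheafData.coe_support_vanishingIdeal Z
  refine ⟨hint', hnoeth', m, m + w - 2, w𝒟 + (2 - 2), ?_, S', hrad, support_host' S Γ hη hτ hm, ?_, ?_⟩
  · -- the `cons` step
    exact IsPureWeightedSeq.cons τ ρ 𝔟₀ 𝔟 _ (vanishingIdeal Z) hseq Γ.regZ hle2 hτ
      (hτ.comap_eq_pow_mul_controlledTransform_of_le_pow hle2)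
  · -- old members: transported with the same exponent
    intro p hp
    refine ⟨(strictTransformIdeal τ (vanishingIdeal Z) p.1, p.2), mem_stepExp_iff.mpr (Or.inl ⟨p, hp, rfl⟩), rfl, ?_, ?_⟩
    · rw [← hZsupp]
      exact preimage_diff_subset_support_strictTransformIdeal τ (vanishingIdeal Z) p.1
    · intro x' hx'
      exact mem_support_of_mem_support_strictTransformIdeal hx'
  · -- every new member is a transform or exceptional
    intro p' hp'
    rcases mem_stepExp_iff.mp hp' with ⟨q, hq, rfl⟩ | rfl
    · refine Or.inl ⟨q, hq, rfl, ?_, fun x' hx' => mem_support_of_mem_support_strictTransformIdeal hx'⟩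
      rw [← hZsupp]
      exact preimage_diff_subset_support_strictTransformIdeal τ (vanishingIdeal Z) q.1
    · refine Or.inr fun x' hx' => ?_
      rw [Scheme.IdealSheafData.support_comap, Closeds.coe_preimage, Scheme.IdealSheafData.coe_support_vanishingIdeal] at hx'
      exact hx'

/-! ## §3 The loop, member-wise -/

/-- The induction behind `pure_pieces_loop_keyed`, on the number of pieces. [cite: BierstoneGrigorievMilmanWlodarczyk2011, §4 Step 2b] -/
private theorem pure_pieces_loop_keyed_aux {E : Scheme.{u}} {𝔟₀ : E.IdealSheafData} (n : ℕ) :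
    ∀ {W : Scheme.{u}} [IsIntegral W] [IsNoetherian W] {ρ : W ⟶ E}
      {𝔟 D : W.IdealSheafData} {ℬ 𝒟 : List (W.IdealSheafData × ℕ)} (_S : StateIn 𝔟 D ℬ 𝒟)
      (_hseq : IsPureWeightedSeq 2 ρ 𝔟₀ 𝔟)
      {C : W.IdealSheafData} (_hC : Scheme.IsRegular C.subscheme)
      {Zs : List (Closeds W)} (_hlen : Zs.length = n) (_hne : Zs ≠ []) (_hP : IsPiecePartition C Zs)
      (_hΓ : ∀ Z ∈ Zs, CentreIn D ℬ Z) (_h2 : ∀ Z ∈ Zs, ∀ z ∈ (Z : Set W), (2 : ℕ∞) ≤ idealOrder 𝔟 z)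
      {W' : Scheme.{u}} {τ : W' ⟶ W} (_hτ : IsBlowup τ C),
      ∃ (_ : IsIntegral W') (_ : IsNoetherian W') (𝔟' D' : W'.IdealSheafData) (ℬ' 𝒟' : List (W'.IdealSheafData × ℕ)),
        IsPureWeightedSeq 2 (τ ≫ ρ) 𝔟₀ 𝔟' ∧ StateIn 𝔟' D' ℬ' 𝒟' ∧
        ((D'.support : Set W') = closure (τ ⁻¹' ((D.support : Set W) \ C.support))) ∧
        (∀ p ∈ ℬ, ∃ p' ∈ ℬ', p'.2 = p.2 ∧
          τ ⁻¹' ((p.1.support : Set W) \ (C.support : Set W)) ⊆ (p'.1.support : Set W') ∧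
          (p'.1.support : Set W') ⊆ τ ⁻¹' (p.1.support : Set W)) ∧
        (∀ p' ∈ ℬ',
          (∃ p ∈ ℬ, p'.2 = p.2 ∧ τ ⁻¹' ((p.1.support : Set W) \ (C.support : Set W)) ⊆ (p'.1.support : Set W') ∧
            (p'.1.support : Set W') ⊆ τ ⁻¹' (p.1.support : Set W)) ∨
          (p'.1.support : Set W') ⊆ τ ⁻¹' (C.support : Set W)) := by
  induction n with
  | zero =>
    intro W _ _ ρ 𝔟 D ℬ 𝒟 S hseq C hC Zs hlen hne
    exact absurd (List.eq_nil_of_length_eq_zero hlen) hne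
  | succ n ih =>
    intro W _ _ ρ 𝔟 D ℬ 𝒟 S hseq C hC Zs hlen hne hP hΓ h2 W' τ hτ
    obtain ⟨Z, Zs', rfl⟩ : ∃ Z Zs', Zs = Z :: Zs' := by
      cases Zs with
      | nil => exact absurd rfl hne
      | cons Z Zs' => exact ⟨Z, Zs', rfl⟩
    have hlen' : Zs'.length = n := by simpa using hlen
    have hZC : (Z : Set W) ⊆ (C.support : Set W) := by
      rw [← hP.2]
      exact Set.subset_iUnion₂ (s := fun (Z' : Closeds W) (_ : Z' ∈ Z :: Zs') => (Z' : Set W)) Z List.mem_cons_self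
    by_cases hnil : Zs' = []
    · -- ONE piece: `C = 𝓘(Z)`
      subst hnil
      have hCZ : C = vanishingIdeal Z := by
        rw [← prod_pieceIdeals_eq_of_isRegular hC hP]; simp [pieceIdeals]
      subst hCZ
      obtain ⟨hint', hnoeth', m, e, e', hseq', S', -, hsupp, hold, hnew⟩ :=
        pure_piece_single_keyed S hseq (hΓ Z List.mem_cons_self) (h2 Z List.mem_cons_self) hτ
      refine ⟨hint', hnoeth', _, _, _, _, hseq', S', ?_, ?_, ?_⟩
      · rw [hsupp, Scheme.IdealSheafData.coe_support_vanishingIdeal]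
      · rw [Scheme.IdealSheafData.coe_support_vanishingIdeal]; exact hold
      · rw [Scheme.IdealSheafData.coe_support_vanishingIdeal]; exact hnew
    · -- SEVERAL pieces: peel the first
      obtain ⟨X₁, τ₁, τ₂, hcomp, hτ₁, -, -, -, -, hτ₂, hC₁, hP₁⟩ := hτ.exists_comp_eq_of_isPiecePartition_cons hC hP
      obtain ⟨hint₁, hnoeth₁, m, e, e', hseq₁, S₁, hrad₁, hsupp₁, hold₁, hnew₁⟩ :=
        pure_piece_single_keyed S hseq (hΓ Z List.mem_cons_self) (h2 Z List.mem_cons_self) hτ₁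
      haveI := hint₁
      haveI := hnoeth₁
      -- the centre data and the order clause of the lifted remaining pieces
      have hΓ₁ : ∀ Z₁ ∈ Zs'.map (fun W₀ : Closeds W => W₀.preimage τ₁.continuous),
          CentreIn (controlledTransform τ₁ (vanishingIdeal Z) D m) (stepExp ℬ τ₁ (vanishingIdeal Z) e) Z₁ := by
        intro Z₁ hZ₁
        obtain ⟨Z₂, hZ₂, rfl⟩ := List.mem_map.mp hZ₁
        exact CentreIn.transport S (hΓ Z List.mem_cons_self) hτ₁ (hΓ Z₂ (List.mem_cons_of_mem _ hZ₂))
          (hP.disjoint_of_mem_tail hZ₂) e hrad₁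
      have h2₁ : ∀ Z₁ ∈ Zs'.map (fun W₀ : Closeds W => W₀.preimage τ₁.continuous),
          ∀ z ∈ (Z₁ : Set X₁), (2 : ℕ∞) ≤ idealOrder (controlledTransform τ₁ (vanishingIdeal Z) 𝔟 2) z := by
        intro Z₁ hZ₁
        obtain ⟨Z₂, hZ₂, rfl⟩ := List.mem_map.mp hZ₁
        exact forall_two_le_transport hτ₁ (hP.disjoint_of_mem_tail hZ₂) (h2 Z₂ (List.mem_cons_of_mem _ hZ₂))
      have hne₁ : Zs'.map (fun W₀ : Closeds W => W₀.preimage τ₁.continuous) ≠ [] := by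
        simpa using hnil
      have hlen₁ : (Zs'.map (fun W₀ : Closeds W => W₀.preimage τ₁.continuous)).length = n := by simpa using hlen'
      -- the support of the remaining centre lies over `⋃ Zs' ⊆ V(C)`
      set T : Set W := ⋃ Z₂ ∈ Zs', (Z₂ : Set W) with hT
      have hC₁supp : (((pieceIdeals (Zs'.map fun W₀ : Closeds W => W₀.preimage τ₁.continuous)).prod).support : Set X₁) =
          τ₁ ⁻¹' T := by
        rw [← hP₁.2, hT]
        ext x
        simp only [List.mem_map, Set.mem_iUnion, exists_prop, Set.mem_preimage]
        constructor
        · rintro ⟨_, ⟨Z₂, hZ₂, rfl⟩, hx⟩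
          exact ⟨Z₂, hZ₂, hx⟩
        · rintro ⟨Z₂, hZ₂, hx⟩
          exact ⟨_, ⟨Z₂, hZ₂, rfl⟩, hx⟩
      have hTC : T ⊆ (C.support : Set W) := by
        rw [← hP.2, hT]
        exact Set.iUnion₂_subset fun Z₂ hZ₂ =>
          Set.subset_iUnion₂ (s := fun (Z' : Closeds W) (_ : Z' ∈ Z :: Zs') => (Z' : Set W)) Z₂ (List.mem_cons_of_mem _ hZ₂)
      have hZT : (Z : Set W) ∪ T = (C.support : Set W) := by
        rw [← hP.2, hT]
        ext x
        simp only [Set.mem_union, Set.mem_iUnion, List.mem_cons, exists_prop]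
        constructor
        · rintro (hx | ⟨Z₂, hZ₂, hx⟩)
          · exact ⟨Z, Or.inl rfl, hx⟩
          · exact ⟨Z₂, Or.inr hZ₂, hx⟩
        · rintro ⟨Z', rfl | hZ', hx⟩
          · exact Or.inl hx
          · exact Or.inr ⟨Z', hZ', hx⟩
      -- the induction hypothesis on the remaining pieces
      obtain ⟨hint', hnoeth', 𝔟', D', ℬ', 𝒟', hseq', S', hsupp', hold', hnew'⟩ :=
        ih S₁ hseq₁ hC₁ hlen₁ hne₁ hP₁ hΓ₁ h2₁ hτ₂
      -- bookkeeping of preimages along `τ = τ₂ ≫ τ₁`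
      have hτx : ∀ x' : W', τ x' = τ₁ (τ₂ x') := fun x' => by
        rw [← hcomp]; simp only [Scheme.Hom.comp_base, TopCat.coe_comp, Function.comp_apply]
      -- composition of the OLD-member relation through the two stages
      have hcompose : ∀ (p : W.IdealSheafData × ℕ) (p₁ : X₁.IdealSheafData × ℕ) (p' : W'.IdealSheafData × ℕ),
          (p₁.2 = p.2 ∧ τ₁ ⁻¹' ((p.1.support : Set W) \ (Z : Set W)) ⊆ (p₁.1.support : Set X₁) ∧
            (p₁.1.support : Set X₁) ⊆ τ₁ ⁻¹' (p.1.support : Set W)) →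
          (p'.2 = p₁.2 ∧ τ₂ ⁻¹' ((p₁.1.support : Set X₁) \
              ((((pieceIdeals (Zs'.map fun W₀ : Closeds W => W₀.preimage τ₁.continuous)).prod).support : Set X₁))) ⊆
              (p'.1.support : Set W') ∧ (p'.1.support : Set W') ⊆ τ₂ ⁻¹' (p₁.1.support : Set X₁)) →
          p'.2 = p.2 ∧ τ ⁻¹' ((p.1.support : Set W) \ (C.support : Set W)) ⊆ (p'.1.support : Set W') ∧
            (p'.1.support : Set W') ⊆ τ ⁻¹' (p.1.support : Set W) := by
        rintro p p₁ p' ⟨he₁, hlo₁, hup₁⟩ ⟨he₂, hlo₂, hup₂⟩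
        refine ⟨he₂.trans he₁, fun x' hx' => ?_, fun x' hx' => ?_⟩
        · obtain ⟨hxS, hxC⟩ := hx'
          have hxS' : τ₁ (τ₂ x') ∈ (p.1.support : Set W) := by rw [← hτx]; exact hxS
          have hxC' : τ₁ (τ₂ x') ∉ (C.support : Set W) := by rw [← hτx]; exact hxC
          rw [← hZT, Set.mem_union, not_or] at hxC'
          refine hlo₂ ⟨hlo₁ ⟨hxS', hxC'.1⟩, ?_⟩
          rw [hC₁supp]
          exact hxC'.2
        · have h1 : τ₁ (τ₂ x') ∈ (p.1.support : Set W) := hup₁ (hup₂ hx')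
          show τ x' ∈ (p.1.support : Set W)
          rw [hτx]; exact h1
      refine ⟨hint', hnoeth', 𝔟', D', ℬ', 𝒟', ?_, S', ?_, ?_, ?_⟩
      · rw [← hcomp, Category.assoc]; exact hseq'
      · -- supports: two-step strict transform = one-step ((L-G))
        rw [hsupp', hsupp₁, hC₁supp, hτ₂.closure_preimage_closure_preimage_diff τ₁ hC₁supp (D.support : Set W) (Z : Set W),
          hcomp, hZT]
      · -- OLD members
        intro p hp
        obtain ⟨p₁, hp₁, hrel₁⟩ := hold₁ p hp
        obtain ⟨p', hp', hrel₂⟩ := hold' p₁ hp₁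
        exact ⟨p', hp', hcompose p p₁ p' hrel₁ hrel₂⟩
      · -- every member of `ℬ'` is a transform or exceptional
        intro p' hp'
        rcases hnew' p' hp' with ⟨p₁, hp₁, hrel₂⟩ | hexc
        · rcases hnew₁ p₁ hp₁ with ⟨p, hp, hrel₁⟩ | hexc₁
          · exact Or.inl ⟨p, hp, hcompose p p₁ p' hrel₁ hrel₂⟩
          · refine Or.inr fun x' hx' => ?_
            have h1 : τ₁ (τ₂ x') ∈ (Z : Set W) := hexc₁ (hrel₂.2.2 hx')
            show τ x' ∈ (C.support : Set W)
            rw [hτx]; exact hZC h1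
        · refine Or.inr fun x' hx' => ?_
          have h1 : τ₂ x' ∈ ((((pieceIdeals (Zs'.map fun W₀ : Closeds W => W₀.preimage τ₁.continuous)).prod).support :
              Set X₁)) := hexc hx'
          rw [hC₁supp] at h1
          have h2' : τ₁ (τ₂ x') ∈ T := h1
          show τ x' ∈ (C.support : Set W)
          rw [hτx]; exact hTC h2'

/-- [OURS · L1 W5.2 · LSDR₃ / LDR₃] **THE PURE WEIGHT-TWO PIECES LOOP, `𝔟`-KEYED, MEMBER-WISE**: from a transport state
`StateIn 𝔟 D ℬ 𝒟` at the end of a pure weight-two sequence `IsPureWeightedSeq 2 ρ 𝔟₀ 𝔟`, a regular centre `C` with a non-empty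
piece partition `Zs`, each piece carrying its `CentreIn` data AND `2 ≤ ord_z 𝔟` AT EACH OF ITS POINTS, and ANY blowing up `τ`
along `C`: the sequence extends along `τ` (one legal weight-two `cons` per piece) to a transport state on `W'` whose host support
is the strict transform `cl τ⁻¹(Supp D ∖ V(C))`, every OLD boundary member `p` having a transform `p' ∈ ℬ'` with the same exponent,
`τ⁻¹(Supp p ∖ V(C)) ⊆ Supp p' ⊆ τ⁻¹ Supp p`, and every member of `ℬ'` being such a transform or exceptional (`Supp ⊆ τ⁻¹ V(C)`).
[cite: BierstoneGrigorievMilmanWlodarczyk2011, §4 Step 2b, Def. 3.1.3, Lemma 3.2.1 (1)] [cite: StacksProject, Tag 080A] -/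
theorem pure_pieces_loop_keyed
    {E W : Scheme.{u}} [IsIntegral W] [IsNoetherian W] {ρ : W ⟶ E} {𝔟₀ : E.IdealSheafData}
    {𝔟 D : W.IdealSheafData} {ℬ 𝒟 : List (W.IdealSheafData × ℕ)} (S : StateIn 𝔟 D ℬ 𝒟)
    (hseq : IsPureWeightedSeq 2 ρ 𝔟₀ 𝔟)
    {C : W.IdealSheafData} (hC : Scheme.IsRegular C.subscheme)
    {Zs : List (Closeds W)} (hne : Zs ≠ []) (hP : IsPiecePartition C Zs) (hΓ : ∀ Z ∈ Zs, CentreIn D ℬ Z)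
    (h2 : ∀ Z ∈ Zs, ∀ z ∈ (Z : Set W), (2 : ℕ∞) ≤ idealOrder 𝔟 z)
    {W' : Scheme.{u}} {τ : W' ⟶ W} (hτ : IsBlowup τ C) :
    ∃ (_ : IsIntegral W') (_ : IsNoetherian W') (𝔟' D' : W'.IdealSheafData) (ℬ' 𝒟' : List (W'.IdealSheafData × ℕ)),
      IsPureWeightedSeq 2 (τ ≫ ρ) 𝔟₀ 𝔟' ∧ StateIn 𝔟' D' ℬ' 𝒟' ∧
      ((D'.support : Set W') = closure (τ ⁻¹' ((D.support : Set W) \ C.support))) ∧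
      (∀ p ∈ ℬ, ∃ p' ∈ ℬ', p'.2 = p.2 ∧
        τ ⁻¹' ((p.1.support : Set W) \ (C.support : Set W)) ⊆ (p'.1.support : Set W') ∧
        (p'.1.support : Set W') ⊆ τ ⁻¹' (p.1.support : Set W)) ∧
      (∀ p' ∈ ℬ',
        (∃ p ∈ ℬ, p'.2 = p.2 ∧ τ ⁻¹' ((p.1.support : Set W) \ (C.support : Set W)) ⊆ (p'.1.support : Set W') ∧
          (p'.1.support : Set W') ⊆ τ ⁻¹' (p.1.support : Set W)) ∨
        (p'.1.support : Set W') ⊆ τ ⁻¹' (C.support : Set W)) :=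
  pure_pieces_loop_keyed_aux Zs.length S hseq hC rfl hne hP hΓ h2 hτ

/-- **Host order `≥ 2` is `𝔟` order `≥ 2`** (`𝔟 ≤ D`): the host-keyed legality of `pure_pieces_loop` implies the `𝔟`-keyed one.
[folklore] -/
theorem StateIn.forall_two_le_of_host {W : Scheme.{u}} [IsLocallyNoetherian W] {𝔟 D : W.IdealSheafData}
    {ℬ 𝒟 : List (W.IdealSheafData × ℕ)} (S : StateIn 𝔟 D ℬ 𝒟) {Z : Set W}
    (h2 : ∀ z ∈ Z, (2 : ℕ∞) ≤ idealOrder D z) : ∀ z ∈ Z, (2 : ℕ∞) ≤ idealOrder 𝔟 z :=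
  fun z hz => (h2 z hz).trans (Kollar2007.Triple.idealOrder_anti S.le_host z)

end WeightTwoB

end Summit.ResolutionOfSingularities.ResolutionOfSingularities.Theorems

end
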